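import Summits.NavierStokesRegularity.NavierStokesRegularity.Theorems.SwirlFreeBudgetEtaAbsorbed
import Literature.Analysis.FluidPDE.ParabolicTenThirds
import HarnessLib

/-!
# SwirlFreeBudget, crux K-18.1 `EtaMoserBound`, step A.5: the `L^{10/3}` bound of the energy
# class for `η = ω_θ/r` (seat nsreg-p4 g13)

Support file for the DORMANT route `SwirlThreshold` (crux stmt-NavierStokesRegularity-2002) and
planner nsreg-p2's ROUND-18 Appendix A (`R18-APPENDIX-EtaMoser.md`, §A.5).  From the absorbed
energy inequality (sibling `…SwirlFreeBudgetEtaAbsorbed`): on `[T₀, T₁]` with `χ(T₀) = 0`,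
`χ = χ̃²`, the energy-class function `g = χ̃ Θ s(f)` satisfies

* `eta_tenThirds_le` — **`∬_{]T₀,T₁[×ℝ³} |g|^{10/3} ≤ C_S² ℛ^{2/3} · 5ℛ`**,
  `ℛ = ∫_{T₀}^{T₁} (𝒦χ + |χ'|) m`, `m(s) = ∫_K H(f(s))`
  (`‖g(t)‖₂² = χM ≤ ℛ`, `‖∇g‖₂² ≤ χ(G_H + 2P)`, `∫χG_H ≤ 4ℛ`, `∫2χP ≤ ℛ`, and the tree's parabolic
  embedding `LeiZhang2011.lintegral_rpow_tenThirds_le_of_slice_bounds`) — the `η`-twin of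
  `Seregin2020.swirl_moser_tenThirds_le` with the drift cost `(1 + A)²` of Chen–Tsai–Zhang 2022
  instead of `‖V‖_{L^{10/3}}` (memo (A.5): CTZ22 (eqA.6) with `Γ ↦ η`).

WHAT THIS IS NOT: not NS regularity — an estimate for the smooth swirl-free class; `EtaMoserBound`
stays OPEN here; no crux claim.
-/

-- the problem directory repeats the summit name (D-0017); core's `dupNamespace` linter fires
set_option linter.dupNamespace false

namespace Summit.NavierStokesRegularity.NavierStokesRegularity.Theorems.SwirlFreeBudget

open MeasureTheory Set Filter Topology Metric Function intervalIntegral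
open scoped RealInnerProductSpace Laplacian ContDiff ENNReal NNReal
open Literature.Analysis Literature.Analysis.FluidPDE Literature.Analysis.FluidPDE.Seregin2020

noncomputable section

section TenThirds

variable {W : ℝ → EuclideanSpace ℝ (Fin 3) → EuclideanSpace ℝ (Fin 3)}
  {f : ℝ → EuclideanSpace ℝ (Fin 3) → ℝ} {lo hi : ℝ}

/-- **The `L^{10/3}` bound of the energy class for `η`** (memo (A.5) before un-wrapping the
cut-offs; the `η`-twin of `Seregin2020.swirl_moser_tenThirds_le`).  In the setting of
`eta_energy_absorbed` on a time interval `[T₀, T₁] ⊆ ]lo, hi[` with `χ(T₀) = 0`, `χ = χ̃²`, the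
energy-class function `g(s, x) = χ̃(s) Θ(x) s(f(s, x))` satisfies
`∬_{]T₀,T₁[ × ℝ³} |g|^{10/3} ≤ C_S² ℛ^{2/3} · 5ℛ`, `ℛ = ∫_{T₀}^{T₁} (𝒦χ + |χ'|) m`
(`‖g(t)‖₂² = χ(t)M(t) ≤ ℛ`, `‖∇g(t)‖₂² ≤ χ(G_H + 2P)`, `∫χG_H ≤ 4ℛ`, `∫2χP ≤ ℛ`, and the tree's
parabolic embedding `LeiZhang2011.lintegral_rpow_tenThirds_le_of_slice_bounds`). -/
theorem eta_tenThirds_le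
    (hf : ∀ τ ∈ Ioo lo hi, ContDiff ℝ 2 (f τ)) (hfax : ∀ τ ∈ Ioo lo hi, IsAxisymmetricScalar (f τ))
    (hW : ∀ τ ∈ Ioo lo hi, ContDiff ℝ 1 (W τ))
    {U : Set (EuclideanSpace ℝ (Fin 3))}
    (hdiv : ∀ τ ∈ Ioo lo hi, ∀ x ∈ U, VectorCalculus.divergence (W τ) x = 0)
    (hfc : ContinuousOn (fun p : ℝ × EuclideanSpace ℝ (Fin 3) => f p.1 p.2) (Ioo lo hi ×ˢ univ))
    (hDc : ContinuousOn (fun p : ℝ × EuclideanSpace ℝ (Fin 3) => fderiv ℝ (f p.1) p.2) (Ioo lo hi ×ˢ univ))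
    (hqfc : ContinuousOn (fun p : ℝ × EuclideanSpace ℝ (Fin 3) => radDerivQuot (f p.1) p.2) (Ioo lo hi ×ˢ univ))
    (hWc : ContinuousOn (fun p : ℝ × EuclideanSpace ℝ (Fin 3) => W p.1 p.2) (Ioo lo hi ×ˢ univ))
    (hLc : ContinuousOn (fun p : ℝ × EuclideanSpace ℝ (Fin 3) =>
      (Δ (f p.1)) p.2 - fderiv ℝ (f p.1) p.2 (W p.1 p.2) + 2 * radDerivQuot (f p.1) p.2) (Ioo lo hi ×ˢ univ))
    (heq : ∀ x ∈ U, ∀ s ∈ Ioo lo hi, ∀ t ∈ Ioo lo hi, s ≤ t →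
      f t x - f s x = ∫ τ in s..t, ((Δ (f τ)) x - fderiv ℝ (f τ) x (W τ x) + 2 * radDerivQuot (f τ) x))
    {H sf : ℝ → ℝ} (hH : ContDiff ℝ 2 H) (hsf : ContDiff ℝ 1 sf) (hsf0 : ∀ v, 0 ≤ sf v)
    (hHs : ∀ v, H v = sf v ^ 2) (hs2 : ∀ v, 2 * deriv sf v ^ 2 ≤ deriv (deriv H) v)
    (hκ : ∀ v, deriv H v ^ 2 ≤ 2 * H v * deriv (deriv H) v)
    {ψ Θ : EuclideanSpace ℝ (Fin 3) → ℝ} (hψ : ContDiff ℝ 1 ψ) (hψ0 : ∀ x, 0 ≤ ψ x) (hψ1 : ∀ x, ψ x ≤ 1)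
    (hΘψ : ∀ x, Θ x = ψ x ^ 2) (hΘax : IsAxisymmetricScalar Θ) {B : ℝ} (hB : 0 ≤ B)
    (hBψ : ∀ x, ‖gradient ψ x‖ ≤ B)
    {K : Set (EuclideanSpace ℝ (Fin 3))} (hK : IsCompact K) (hψK : tsupport ψ ⊆ K) (hKU : K ⊆ U)
    {q : EuclideanSpace ℝ (Fin 3) → ℝ} (hqc : Continuous q) (hqK : ∀ x, x ∉ K → q x = 0)
    (hqax : IsAxisymmetricScalar q) {Q : ℝ} (hQ : ∀ x, |q x| ≤ Q)
    (hq : ∀ x : EuclideanSpace ℝ (Fin 3), x 0 * q x = fderiv ℝ (fun y => Θ y ^ 2) x (EuclideanSpace.single 0 1))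
    {χ χt : ℝ → ℝ} (hχ : ContDiff ℝ 1 χ) (hχχt : ∀ s, χ s = χt s ^ 2)
    {T₀ T₁ : ℝ} (h0 : lo < T₀) (h01 : T₀ < T₁) (h1 : T₁ < hi) (hχT₀ : χ T₀ = 0)
    {wbar : ℝ} (hwbar : ∀ s ∈ Icc T₀ T₁, ∫ x in K, ‖W s x‖ ^ 2 ≤ wbar)
    {m : ℝ → ℝ} (hm : ∀ s, m s = ∫ x in K, H (f s x)) :
    ∫⁻ p, ‖χt p.1 * (Θ p.2 * sf (f p.1 p.2))‖ₑ ^ (10 / 3 : ℝ) ∂((volume.restrict (Ioo T₀ T₁)).prod volume) ≤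
      (SNormLESNormFDerivOfEqConst ℝ (volume : Measure (EuclideanSpace ℝ (Fin 3))) 2 : ℝ≥0∞) ^ 2 *
        ENNReal.ofReal (∫ s in T₀..T₁, ((18 * B ^ 2 + 1728 * B ^ 4 *
          (SNormLESNormFDerivOfEqConst ℝ (volume : Measure (EuclideanSpace ℝ (Fin 3))) 2 : ℝ) ^ 6 * wbar ^ 2 +
          2 * Q) * χ s + |deriv χ s|) * m s) ^ (2 / 3 : ℝ) *
        (5 * ENNReal.ofReal (∫ s in T₀..T₁, ((18 * B ^ 2 + 1728 * B ^ 4 *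
          (SNormLESNormFDerivOfEqConst ℝ (volume : Measure (EuclideanSpace ℝ (Fin 3))) 2 : ℝ) ^ 6 * wbar ^ 2 +
          2 * Q) * χ s + |deriv χ s|) * m s)) := by
  set CS : ℝ := (SNormLESNormFDerivOfEqConst ℝ (volume : Measure (EuclideanSpace ℝ (Fin 3))) 2 : ℝ) with hCS
  set 𝒦 : ℝ := 18 * B ^ 2 + 1728 * B ^ 4 * CS ^ 6 * wbar ^ 2 + 2 * Q with h𝒦
  obtain ⟨R, hR⟩ : ∃ R : ℝ → ℝ, ∀ s, R s = (𝒦 * χ s + |deriv χ s|) * m s := ⟨_, fun _ => rfl⟩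
  have hRfun : (fun s => (𝒦 * χ s + |deriv χ s|) * m s) = R := funext fun s => (hR s).symm
  rw [hRfun]
  set ℛ : ℝ := ∫ s in T₀..T₁, R s with hℛ
  set ν : Measure ℝ := volume.restrict (Ioo T₀ T₁) with hν
  -- the functionals
  obtain ⟨M, hM⟩ : ∃ M : ℝ → ℝ, ∀ s, M s = ∫ x, H (f s x) * Θ x ^ 2 := ⟨_, fun _ => rfl⟩
  obtain ⟨GH, hGH⟩ : ∃ GH : ℝ → ℝ, ∀ s, GH s =
      ∫ x, deriv (deriv H) (f s x) * ‖gradient (f s) x‖ ^ 2 * Θ x ^ 2 := ⟨_, fun _ => rfl⟩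
  obtain ⟨Pf, hPf⟩ : ∃ Pf : ℝ → ℝ, ∀ s, Pf s = ∫ x, H (f s x) * ‖gradient Θ x‖ ^ 2 := ⟨_, fun _ => rfl⟩
  -- regularity
  have hΘfun : Θ = fun y => ψ y ^ 2 := funext hΘψ
  have hΘ : ContDiff ℝ 1 Θ := by rw [hΘfun]; exact hψ.pow 2
  have hKc : IsClosed K := hK.isClosed
  have hψ0K : ∀ x, x ∉ K → ψ x = 0 := fun x hx => image_eq_zero_of_notMem_tsupport fun h => hx (hψK h)
  have hΘ0K : ∀ x, x ∉ K → Θ x = 0 := fun x hx => by rw [hΘψ, hψ0K x hx]; ring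
  have hΘK : tsupport Θ ⊆ K := closure_minimal (fun y hy => by by_contra h'; exact hy (hΘ0K y h')) hKc
  have hΘc : HasCompactSupport Θ := hK.of_isClosed_subset (isClosed_tsupport _) hΘK
  have hH0 : ∀ v, 0 ≤ H v := fun v => by rw [hHs]; exact sq_nonneg _
  have hH2 : ∀ v, 0 ≤ deriv (deriv H) v := fun v => (mul_nonneg zero_le_two (sq_nonneg _)).trans (hs2 v)
  have hH' : ContDiff ℝ 1 (deriv H) := by
    have h2' : ContDiff ℝ (1 + 1) H := by rw [one_add_one_eq_two]; exact hH
    exact h2'.deriv'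
  have hχ0 : ∀ s, 0 ≤ χ s := fun s => by rw [hχχt s]; exact sq_nonneg _
  have hQ0 : 0 ≤ Q := (abs_nonneg _).trans (hQ 0)
  have h𝒦8 : 8 * B ^ 2 ≤ 𝒦 := by rw [h𝒦]; nlinarith [sq_nonneg B, sq_nonneg (B ^ 2 * CS ^ 3 * wbar), hQ0]
  have h𝒦0 : 0 ≤ 𝒦 := le_trans (by positivity) h𝒦8
  have hIcc : Icc T₀ T₁ ⊆ Ioo lo hi := fun r hr => ⟨lt_of_lt_of_le h0 hr.1, lt_of_le_of_lt hr.2 h1⟩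
  have cχ : Continuous χ := hχ.continuous
  have cχ' : Continuous (deriv χ) := hχ.continuous_deriv le_rfl
  -- slice bounds on `[T₀, T₁]`
  have hsl : ∀ s ∈ Icc T₀ T₁, 0 ≤ m s ∧ M s ≤ m s ∧ Pf s ≤ 4 * B ^ 2 * m s ∧ 0 ≤ M s ∧ 0 ≤ GH s := by
    intro s hs
    have cF : Continuous (f s) := (hf s (hIcc hs)).continuous
    obtain ⟨hm0, hMm, hPm⟩ := eta_slice_mass_bounds cF hH.continuous hH0 hψ hψ0 hψ1 hΘψ hBψ hK hψK
    rw [← hm s] at hm0 hMm hPm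
    rw [← hM s] at hMm
    rw [← hPf s] at hPm
    refine ⟨hm0, hMm, hPm, ?_, ?_⟩
    · rw [hM s]; exact integral_nonneg fun x => mul_nonneg (hH0 _) (sq_nonneg _)
    · rw [hGH s]; exact integral_nonneg fun x => mul_nonneg (mul_nonneg (hH2 _) (sq_nonneg _)) (sq_nonneg _)
  have hR0 : ∀ s ∈ Icc T₀ T₁, 0 ≤ R s := fun s hs => by
    rw [hR s]
    have := hχ0 s
    have := (hsl s hs).1
    positivity
  -- integrability in time
  have iim : IntervalIntegrable m volume T₀ T₁ := intervalIntegrable_sliceMass hfc hH.continuous hK hm h0 h01.le h1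
  have iiR : IntervalIntegrable R volume T₀ T₁ := by
    rw [← hRfun]
    exact iim.continuousOn_mul ((continuous_const.mul cχ).add cχ'.abs).continuousOn
  -- the energy class bounds at every `t ∈ [T₀, T₁]`
  have hEC : ∀ t ∈ Icc T₀ T₁, χ t * M t ≤ ℛ ∧ 1 / 4 * ∫ s in T₀..t, χ s * GH s ≤ ℛ ∧
      0 ≤ χ t * M t ∧ 0 ≤ ∫ s in T₀..t, χ s * GH s := by
    intro t ht
    have hth : t < hi := lt_of_le_of_lt ht.2 h1
    have habs := eta_energy_absorbed hf hfax hW hdiv hfc hDc hqfc hWc hLc heq hH hsf hsf0 hHs hs2 hκ hψ hψ0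
      hψ1 hΘψ hΘax hB hBψ hK hψK hKU hqc hqK hqax hQ hq hχ hχ0 h0 ht.1 hth hχT₀
      (fun s hs => hwbar s ⟨hs.1, hs.2.trans ht.2⟩) hM hGH hm
    have hRt : ∫ s in T₀..t, (𝒦 * χ s + |deriv χ s|) * m s ≤ ℛ := by
      rw [show (∫ s in T₀..t, (𝒦 * χ s + |deriv χ s|) * m s) = ∫ s in T₀..t, R s from
        intervalIntegral.integral_congr fun s _ => (hR s).symm]
      refine intervalIntegral.integral_mono_interval le_rfl ht.1 ht.2 ?_ iiR
      exact (ae_restrict_iff' measurableSet_Ioc).2 (ae_of_all _ fun s hs => hR0 s ⟨hs.1.le, hs.2⟩)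
    have hMnn : 0 ≤ χ t * M t := mul_nonneg (hχ0 t) (hsl t ht).2.2.2.1
    have hGnn : 0 ≤ ∫ s in T₀..t, χ s * GH s :=
      intervalIntegral.integral_nonneg ht.1 fun s hs => mul_nonneg (hχ0 s) (hsl s ⟨hs.1, hs.2.trans ht.2⟩).2.2.2.2
    exact ⟨by linarith, by linarith, hMnn, hGnn⟩
  have hℛ0 : 0 ≤ ℛ := by
    have := (hEC T₀ ⟨le_rfl, h01.le⟩).1
    have := (hEC T₀ ⟨le_rfl, h01.le⟩).2.2.1
    linarith
  -- the energy-class function, slice by slice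
  set g : ℝ → EuclideanSpace ℝ (Fin 3) → ℝ := fun s x => χt s * (Θ x * sf (f s x)) with hg
  have hgC : ∀ s ∈ Ioo T₀ T₁, ContDiff ℝ 1 (g s) := fun s hs =>
    contDiff_const.mul (hΘ.mul (hsf.comp ((hf s (hIcc ⟨hs.1.le, hs.2.le⟩)).of_le one_le_two)))
  have hg0 : ∀ s x, x ∉ K → g s x = 0 := fun s x hx => by simp [hg, hΘ0K x hx]
  have hgcs : ∀ s, HasCompactSupport (g s) := fun s => HasCompactSupport.intro hK (hg0 s)
  have hgK : ∀ s, tsupport (g s) ⊆ K := fun s =>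
    closure_minimal (fun x hx => by by_contra h; exact hx (hg0 s x h)) hKc
  -- (1) slices are `C¹` and square integrable
  have hg_ae : ∀ᵐ s ∂ν, ContDiff ℝ 1 (g s) :=
    (ae_restrict_iff' measurableSet_Ioo).2 (ae_of_all _ fun s hs => hgC s hs)
  have hg2 : ∀ᵐ s ∂ν, eLpNorm (g s) 2 (volume : Measure (EuclideanSpace ℝ (Fin 3))) < (⊤ : ℝ≥0∞) :=
    (ae_restrict_iff' measurableSet_Ioo).2 (ae_of_all _ fun s hs =>
      ((hgC s hs).continuous.memLp_of_hasCompactSupport (hgcs s)).eLpNorm_lt_top)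
  -- (2) the `L²` slice bound
  have enorm_sq : ∀ r : ℝ, ‖r‖ₑ ^ 2 = ENNReal.ofReal (r ^ 2) := fun r => by
    rw [Real.enorm_eq_ofReal_abs, ← ENNReal.ofReal_pow (abs_nonneg r), sq_abs]
  have hMst : ∀ᵐ s ∂ν, ∫⁻ x, ‖g s x‖ₑ ^ 2 ≤ ENNReal.ofReal ℛ := by
    refine (ae_restrict_iff' measurableSet_Ioo).2 (ae_of_all _ fun s hs => ?_)
    have hint : Integrable fun x => g s x ^ 2 :=
      ((hgC s hs).continuous.pow 2).integrable_of_hasCompactSupport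
        (HasCompactSupport.intro hK fun x hx => by simp [hg0 s x hx])
    have e1 : ∫⁻ x, ‖g s x‖ₑ ^ 2 = ENNReal.ofReal (∫ x, g s x ^ 2) := by
      simp_rw [enorm_sq]
      rw [ofReal_integral_eq_lintegral_ofReal hint (ae_of_all _ fun x => sq_nonneg _)]
    have e2 : ∫ x, g s x ^ 2 = χ s * M s := by
      rw [hM s, ← MeasureTheory.integral_const_mul]
      refine integral_congr_ae (ae_of_all _ fun x => ?_)
      simp only [hg, hHs, hχχt]
      ring
    rw [e1, e2]
    exact ENNReal.ofReal_le_ofReal (hEC s ⟨hs.1.le, hs.2.le⟩).1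
  -- (3) the gradient slice bound
  obtain ⟨T₁', hT₁'⟩ : ∃ T₁' : ℝ → ℝ, ∀ s, T₁' s = ∫ x, deriv H (f s x) *
      ⟪gradient (f s) x, gradient (fun y => Θ y ^ 2) x⟫ := ⟨_, fun _ => rfl⟩
  obtain ⟨TW, hTW⟩ : ∃ TW : ℝ → ℝ, ∀ s, TW s = ∫ x, H (f s x) * ⟪W s x, gradient (fun y => Θ y ^ 2) x⟫ :=
    ⟨_, fun _ => rfl⟩
  obtain ⟨Ta, hTa⟩ : ∃ Ta : ℝ → ℝ, ∀ s, Ta s = ∫ x, deriv H (f s x) * radDerivQuot (f s) x * Θ x ^ 2 :=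
    ⟨_, fun _ => rfl⟩
  obtain ⟨-, cGH, -, cPf, -, -⟩ :=
    continuousOn_eta_sliceFunctionals hfc hDc hqfc hWc hH hΘ hΘc hM hGH hT₁' hPf hTW hTa
  set Wf : ℝ → ℝ≥0∞ := fun s => ENNReal.ofReal (χ s * GH s + 2 * (χ s * Pf s)) with hWf
  have hWm : AEMeasurable Wf ν := by
    have hc : ContinuousOn (fun s => χ s * GH s + 2 * (χ s * Pf s)) (Ioo T₀ T₁) :=
      ((cχ.continuousOn.mul (cGH.mono (fun s hs => hIcc ⟨hs.1.le, hs.2.le⟩))).add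
        (continuousOn_const.mul (cχ.continuousOn.mul (cPf.mono (fun s hs => hIcc ⟨hs.1.le, hs.2.le⟩)))))
    exact ENNReal.measurable_ofReal.comp_aemeasurable (hc.aemeasurable measurableSet_Ioo)
  have hWb : ∀ᵐ s ∂ν, ∫⁻ x, ‖fderiv ℝ (g s) x‖ₑ ^ 2 ≤ Wf s := by
    refine (ae_restrict_iff' measurableSet_Ioo).2 (ae_of_all _ fun s hs => ?_)
    have hsI : s ∈ Ioo lo hi := hIcc ⟨hs.1.le, hs.2.le⟩
    have hF1 : ContDiff ℝ 1 (f s) := (hf s hsI).of_le one_le_two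
    have cF : Continuous (f s) := hF1.continuous
    have cgF : Continuous (gradient (f s)) := continuous_gradient_of_contDiff hF1
    have cΘ2 : Continuous fun y : EuclideanSpace ℝ (Fin 3) => Θ y ^ 2 := hΘ.continuous.pow 2
    have cgΘ : Continuous (gradient Θ) := continuous_gradient_of_contDiff hΘ
    have hpt : ∀ x, ‖fderiv ℝ (g s) x‖ ^ 2 ≤
        χ s * (deriv (deriv H) (f s x) * ‖gradient (f s) x‖ ^ 2 * Θ x ^ 2) +
          2 * (χ s * (H (f s x) * ‖gradient Θ x‖ ^ 2)) := by
      intro x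
      have hFd : DifferentiableAt ℝ (f s) x := (hF1.differentiable one_ne_zero) x
      have hΘd : DifferentiableAt ℝ Θ x := (hΘ.differentiable one_ne_zero) x
      have hin : DifferentiableAt ℝ (fun y => Θ y * sf (f s y)) x :=
        hΘd.mul (((hsf.differentiable one_ne_zero) _).comp x hFd)
      have e : fderiv ℝ (g s) x = χt s • fderiv ℝ (fun y => Θ y * sf (f s y)) x := by
        simp only [hg]
        exact fderiv_const_mul hin (χt s)
      rw [e, norm_smul, mul_pow, Real.norm_eq_abs, sq_abs, ← hχχt]
      have h := norm_fderiv_mul_comp_sq_le_at hFd hΘd hsf hs2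
      calc χ s * ‖fderiv ℝ (fun y => Θ y * sf (f s y)) x‖ ^ 2
          ≤ χ s * (deriv (deriv H) (f s x) * ‖gradient (f s) x‖ ^ 2 * Θ x ^ 2 +
            2 * sf (f s x) ^ 2 * ‖gradient Θ x‖ ^ 2) := mul_le_mul_of_nonneg_left h (hχ0 s)
        _ = _ := by rw [← hHs]; ring
    have hsupp : ∀ {u : EuclideanSpace ℝ (Fin 3) → ℝ}, Continuous u → (∀ x, x ∉ K → u x = 0) →
        Integrable u := fun hu h0' => hu.integrable_of_hasCompactSupport (HasCompactSupport.intro hK h0')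
    have iA : Integrable fun x => deriv (deriv H) (f s x) * ‖gradient (f s) x‖ ^ 2 * Θ x ^ 2 :=
      hsupp ((((hH'.continuous_deriv le_rfl).comp cF).mul (cgF.norm.pow 2)).mul cΘ2)
        (fun x hx => by simp [hΘ0K x hx])
    have iB : Integrable fun x => H (f s x) * ‖gradient Θ x‖ ^ 2 :=
      hsupp ((hH.continuous.comp cF).mul (cgΘ.norm.pow 2)) (fun x hx => by
        rw [gradient_eq_zero_of_notMem_tsupport (fun h => hx (hΘK h)), norm_zero]; ring)
    have iRHS : Integrable fun x => χ s * (deriv (deriv H) (f s x) * ‖gradient (f s) x‖ ^ 2 * Θ x ^ 2) +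
        2 * (χ s * (H (f s x) * ‖gradient Θ x‖ ^ 2)) :=
      (iA.const_mul _).add ((iB.const_mul _).const_mul _)
    have hRHSnn : ∀ x, 0 ≤ χ s * (deriv (deriv H) (f s x) * ‖gradient (f s) x‖ ^ 2 * Θ x ^ 2) +
        2 * (χ s * (H (f s x) * ‖gradient Θ x‖ ^ 2)) := fun x => by
      have := hχ0 s; have := hH2 (f s x); have := hH0 (f s x)
      positivity
    have eRHS : ∫ x, (χ s * (deriv (deriv H) (f s x) * ‖gradient (f s) x‖ ^ 2 * Θ x ^ 2) +
        2 * (χ s * (H (f s x) * ‖gradient Θ x‖ ^ 2))) = χ s * GH s + 2 * (χ s * Pf s) := by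
      rw [integral_add (iA.const_mul _) ((iB.const_mul _).const_mul _), MeasureTheory.integral_const_mul,
        MeasureTheory.integral_const_mul, MeasureTheory.integral_const_mul, ← hGH s, ← hPf s]
    calc ∫⁻ x, ‖fderiv ℝ (g s) x‖ₑ ^ 2 = ∫⁻ x, ENNReal.ofReal (‖fderiv ℝ (g s) x‖ ^ 2) := by
          refine lintegral_congr fun x => ?_
          rw [← enorm_norm, enorm_sq]
      _ ≤ ∫⁻ x, ENNReal.ofReal (χ s * (deriv (deriv H) (f s x) * ‖gradient (f s) x‖ ^ 2 * Θ x ^ 2) +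
            2 * (χ s * (H (f s x) * ‖gradient Θ x‖ ^ 2))) :=
          lintegral_mono fun x => ENNReal.ofReal_le_ofReal (hpt x)
      _ = Wf s := by
          rw [← ofReal_integral_eq_lintegral_ofReal iRHS (ae_of_all _ hRHSnn), eRHS]
  -- (4) the parabolic embedding
  have hemb := LeiZhang2011.lintegral_rpow_tenThirds_le_of_slice_bounds (ν := ν) hg_ae hg2 hMst hWm hWb
  -- (5) `∫⁻ W ≤ 5 ℛ`
  have hWle : ∫⁻ s, Wf s ∂ν ≤ 5 * ENNReal.ofReal ℛ := by
    have iiχGH : IntervalIntegrable (fun s => χ s * GH s) volume T₀ T₁ := by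
      refine ((cGH.mono ?_).intervalIntegrable).continuousOn_mul cχ.continuousOn
      rw [uIcc_of_le h01.le]; exact hIcc
    have iiχPf : IntervalIntegrable (fun s => 2 * (χ s * Pf s)) volume T₀ T₁ := by
      refine (((cPf.mono ?_).intervalIntegrable).continuousOn_mul cχ.continuousOn).const_mul 2
      rw [uIcc_of_le h01.le]; exact hIcc
    have iiS : IntervalIntegrable (fun s => χ s * GH s + 2 * (χ s * Pf s)) volume T₀ T₁ := iiχGH.add iiχPf
    have hnn : ∀ s ∈ Icc T₀ T₁, 0 ≤ χ s * GH s + 2 * (χ s * Pf s) := fun s hs => by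
      have := hχ0 s; have := (hsl s hs).2.2.2.2
      have hP0 : 0 ≤ Pf s := by rw [hPf s]; exact integral_nonneg fun x => mul_nonneg (hH0 _) (sq_nonneg _)
      positivity
    have e1 : ∫⁻ s, Wf s ∂ν = ENNReal.ofReal (∫ s in T₀..T₁, (χ s * GH s + 2 * (χ s * Pf s))) := by
      rw [hν, intervalIntegral.integral_of_le h01.le, integral_Ioc_eq_integral_Ioo,
        ofReal_integral_eq_lintegral_ofReal (iiS.1.mono_set Ioo_subset_Ioc_self)
          ((ae_restrict_iff' measurableSet_Ioo).2 (ae_of_all _ fun s hs => hnn s ⟨hs.1.le, hs.2.le⟩))]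
    have hGHle : ∫ s in T₀..T₁, χ s * GH s ≤ 4 * ℛ := by
      have := (hEC T₁ ⟨h01.le, le_rfl⟩).2.1
      linarith
    have hPfle : ∫ s in T₀..T₁, 2 * (χ s * Pf s) ≤ ℛ := by
      refine intervalIntegral.integral_mono_on h01.le iiχPf iiR fun s hs => ?_
      obtain ⟨hm0, -, hPm, -, -⟩ := hsl s hs
      rw [hR s]
      have := hχ0 s
      have e1 := mul_le_mul_of_nonneg_left hPm this
      nlinarith [mul_nonneg this hm0, abs_nonneg (deriv χ s), h𝒦8]
    rw [e1, intervalIntegral.integral_add iiχGH iiχPf, show (5 : ℝ≥0∞) = ENNReal.ofReal 5 by norm_num,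
      ← ENNReal.ofReal_mul (by norm_num)]
    exact ENNReal.ofReal_le_ofReal (by linarith)
  -- (6) conclusion
  calc ∫⁻ p, ‖χt p.1 * (Θ p.2 * sf (f p.1 p.2))‖ₑ ^ (10 / 3 : ℝ) ∂(ν.prod volume)
      = ∫⁻ p, ‖g p.1 p.2‖ₑ ^ (10 / 3 : ℝ) ∂(ν.prod volume) := rfl
    _ ≤ (SNormLESNormFDerivOfEqConst ℝ (volume : Measure (EuclideanSpace ℝ (Fin 3))) 2 : ℝ≥0∞) ^ 2 *
          ENNReal.ofReal ℛ ^ (2 / 3 : ℝ) * ∫⁻ s, Wf s ∂ν := hemb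
    _ ≤ (SNormLESNormFDerivOfEqConst ℝ (volume : Measure (EuclideanSpace ℝ (Fin 3))) 2 : ℝ≥0∞) ^ 2 *
          ENNReal.ofReal ℛ ^ (2 / 3 : ℝ) * (5 * ENNReal.ofReal ℛ) := mul_le_mul_right hWle _

end TenThirds

end

end Summit.NavierStokesRegularity.NavierStokesRegularity.Theorems.SwirlFreeBudget
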